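import Mathlib
import Summits.Ventures.PercRepro2.RootPairSepTypedPendant

/-!
# Pendant pieces for the TYPED bracket β₁ = (HALF-PM⁺)_L + (HALF-PM⁺)_H + A
(blind cell PercRepro2, mine-2 g21; proofs/MINE2-CUTU.md §10.5; the weighted L-half versions are in
`RootPairSepPendant.lean`, the structural lemmas and `prob_pendant_mul` in `RootPairSepCut.lean`).

With `c` a cut vertex (`IsRootPairSep ends c c V₁ V₂`), both roots in `V₁` and `γ_v = {v ↔ c inside V₂}`:
a pendant `u` gives `β₁(o, u, b) = P(γ_u) · β₁(o, c, b) − (1 − P(γ_u)) · 2 P(Q) Xt` with `Xt ≤ 0` the sum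
of the two BHK 1.4 brackets (`beta1_pendant_u`), hence `β₁(o, u, b) ≥ P(γ_u) · β₁(o, c, b)`
(`beta1_pendant_u_ge`).  Pendant `b`, `o` and `prob_pendant_union_mul` are in `RootPairSepTypedPendant.lean`.
-/

namespace Summit.Ventures.PercRepro2

namespace RootPairSep

open SepPair

section Main

variable {V : Type*} {E : Type*} [Fintype E] [DecidableEq E] {R : Type*} [CommRing R]

/-- **Pendant `u`, typed.**  `β₁(o, u, b) = P(γ_u) · β₁(o, c, b) − (1 − P(γ_u)) · 2·P(Q)·Xt`, with `Xt` the sum of the two BHK 1.4 brackets of `A`. -/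
theorem beta1_pendant_u (p : E → R) {ends : E → Sym2 V} {c a₁ a₂ : V} {V₁ V₂ : Set V}
    (hs : IsRootPairSep ends c c V₁ V₂) [DecidablePred (· ∈ side₁ ends V₁)]
    [DecidablePred (· ∈ (side₁ ends V₁)ᶜ)] (ha₁ : a₁ ∈ V₁) (ha₂ : a₂ ∈ V₁) {o u b : V}
    (ho : o ∈ V₁) (hu : u ∈ V₂) (hb : b ∈ V₁) :
    prob p (connEvent ends a₁ a₂)ᶜ *
          (prob p (connEvent ends a₁ a₂)ᶜ * prob p (connEvent ends a₁ b ∩ connEvent ends a₂ u ∩ (connEvent ends a₁ o ∪ connEvent ends a₂ o) ∩ (connEvent ends a₁ a₂)ᶜ) -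
            prob p (connEvent ends a₁ b ∩ (connEvent ends a₁ a₂)ᶜ) * prob p (connEvent ends a₂ u ∩ (connEvent ends a₁ o ∪ connEvent ends a₂ o) ∩ (connEvent ends a₁ a₂)ᶜ)) -
        prob p ((connEvent ends a₁ o ∪ connEvent ends a₂ o) ∩ (connEvent ends a₁ a₂)ᶜ) *
          (prob p (connEvent ends a₁ a₂)ᶜ * prob p (connEvent ends a₁ b ∩ connEvent ends a₂ u ∩ (connEvent ends a₁ a₂)ᶜ) -
            prob p (connEvent ends a₁ b ∩ (connEvent ends a₁ a₂)ᶜ) * prob p (connEvent ends a₂ u ∩ (connEvent ends a₁ a₂)ᶜ)) -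
        prob p (connEvent ends a₁ a₂)ᶜ *
          (prob p (connEvent ends a₁ a₂)ᶜ * prob p (connEvent ends a₁ b ∩ connEvent ends a₂ o ∩ (connEvent ends a₁ a₂)ᶜ) -
            prob p (connEvent ends a₁ b ∩ (connEvent ends a₁ a₂)ᶜ) * prob p (connEvent ends a₂ o ∩ (connEvent ends a₁ a₂)ᶜ)) +
        prob p (connEvent ends a₁ a₂)ᶜ *
          (prob p (connEvent ends a₁ a₂)ᶜ * prob p (connEvent ends a₂ b ∩ connEvent ends a₁ u ∩ (connEvent ends a₁ o ∪ connEvent ends a₂ o) ∩ (connEvent ends a₁ a₂)ᶜ) -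
            prob p (connEvent ends a₂ b ∩ (connEvent ends a₁ a₂)ᶜ) * prob p (connEvent ends a₁ u ∩ (connEvent ends a₁ o ∪ connEvent ends a₂ o) ∩ (connEvent ends a₁ a₂)ᶜ)) -
        prob p ((connEvent ends a₁ o ∪ connEvent ends a₂ o) ∩ (connEvent ends a₁ a₂)ᶜ) *
          (prob p (connEvent ends a₁ a₂)ᶜ * prob p (connEvent ends a₂ b ∩ connEvent ends a₁ u ∩ (connEvent ends a₁ a₂)ᶜ) -
            prob p (connEvent ends a₂ b ∩ (connEvent ends a₁ a₂)ᶜ) * prob p (connEvent ends a₁ u ∩ (connEvent ends a₁ a₂)ᶜ)) -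
        prob p (connEvent ends a₁ a₂)ᶜ *
          (prob p (connEvent ends a₁ a₂)ᶜ * prob p (connEvent ends a₂ b ∩ connEvent ends a₁ o ∩ (connEvent ends a₁ a₂)ᶜ) -
            prob p (connEvent ends a₂ b ∩ (connEvent ends a₁ a₂)ᶜ) * prob p (connEvent ends a₁ o ∩ (connEvent ends a₁ a₂)ᶜ)) +
        (prob p ((connEvent ends a₁ u ∪ connEvent ends a₂ u) ∩ (connEvent ends a₁ a₂)ᶜ) - prob p (connEvent ends a₁ a₂)ᶜ) *
          (prob p (connEvent ends a₁ a₂)ᶜ * prob p (connEvent ends a₁ b ∩ connEvent ends a₂ o ∩ (connEvent ends a₁ a₂)ᶜ) - prob p (connEvent ends a₁ b ∩ (connEvent ends a₁ a₂)ᶜ) * prob p (connEvent ends a₂ o ∩ (connEvent ends a₁ a₂)ᶜ) +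
            prob p (connEvent ends a₁ a₂)ᶜ * prob p (connEvent ends a₂ b ∩ connEvent ends a₁ o ∩ (connEvent ends a₁ a₂)ᶜ) - prob p (connEvent ends a₂ b ∩ (connEvent ends a₁ a₂)ᶜ) * prob p (connEvent ends a₁ o ∩ (connEvent ends a₁ a₂)ᶜ)) =
      prob p (restrictTo (side₁ ends V₁)ᶜ ⁻¹' connEvent ends u c) *
       (        prob p (connEvent ends a₁ a₂)ᶜ *
              (prob p (connEvent ends a₁ a₂)ᶜ * prob p (connEvent ends a₁ b ∩ connEvent ends a₂ c ∩ (connEvent ends a₁ o ∪ connEvent ends a₂ o) ∩ (connEvent ends a₁ a₂)ᶜ) -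
                prob p (connEvent ends a₁ b ∩ (connEvent ends a₁ a₂)ᶜ) * prob p (connEvent ends a₂ c ∩ (connEvent ends a₁ o ∪ connEvent ends a₂ o) ∩ (connEvent ends a₁ a₂)ᶜ)) -
            prob p ((connEvent ends a₁ o ∪ connEvent ends a₂ o) ∩ (connEvent ends a₁ a₂)ᶜ) *
              (prob p (connEvent ends a₁ a₂)ᶜ * prob p (connEvent ends a₁ b ∩ connEvent ends a₂ c ∩ (connEvent ends a₁ a₂)ᶜ) -
                prob p (connEvent ends a₁ b ∩ (connEvent ends a₁ a₂)ᶜ) * prob p (connEvent ends a₂ c ∩ (connEvent ends a₁ a₂)ᶜ)) -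
            prob p (connEvent ends a₁ a₂)ᶜ *
              (prob p (connEvent ends a₁ a₂)ᶜ * prob p (connEvent ends a₁ b ∩ connEvent ends a₂ o ∩ (connEvent ends a₁ a₂)ᶜ) -
                prob p (connEvent ends a₁ b ∩ (connEvent ends a₁ a₂)ᶜ) * prob p (connEvent ends a₂ o ∩ (connEvent ends a₁ a₂)ᶜ)) +
            prob p (connEvent ends a₁ a₂)ᶜ *
              (prob p (connEvent ends a₁ a₂)ᶜ * prob p (connEvent ends a₂ b ∩ connEvent ends a₁ c ∩ (connEvent ends a₁ o ∪ connEvent ends a₂ o) ∩ (connEvent ends a₁ a₂)ᶜ) -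
                prob p (connEvent ends a₂ b ∩ (connEvent ends a₁ a₂)ᶜ) * prob p (connEvent ends a₁ c ∩ (connEvent ends a₁ o ∪ connEvent ends a₂ o) ∩ (connEvent ends a₁ a₂)ᶜ)) -
            prob p ((connEvent ends a₁ o ∪ connEvent ends a₂ o) ∩ (connEvent ends a₁ a₂)ᶜ) *
              (prob p (connEvent ends a₁ a₂)ᶜ * prob p (connEvent ends a₂ b ∩ connEvent ends a₁ c ∩ (connEvent ends a₁ a₂)ᶜ) -
                prob p (connEvent ends a₂ b ∩ (connEvent ends a₁ a₂)ᶜ) * prob p (connEvent ends a₁ c ∩ (connEvent ends a₁ a₂)ᶜ)) -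
            prob p (connEvent ends a₁ a₂)ᶜ *
              (prob p (connEvent ends a₁ a₂)ᶜ * prob p (connEvent ends a₂ b ∩ connEvent ends a₁ o ∩ (connEvent ends a₁ a₂)ᶜ) -
                prob p (connEvent ends a₂ b ∩ (connEvent ends a₁ a₂)ᶜ) * prob p (connEvent ends a₁ o ∩ (connEvent ends a₁ a₂)ᶜ)) +
            (prob p ((connEvent ends a₁ c ∪ connEvent ends a₂ c) ∩ (connEvent ends a₁ a₂)ᶜ) - prob p (connEvent ends a₁ a₂)ᶜ) *
              (prob p (connEvent ends a₁ a₂)ᶜ * prob p (connEvent ends a₁ b ∩ connEvent ends a₂ o ∩ (connEvent ends a₁ a₂)ᶜ) - prob p (connEvent ends a₁ b ∩ (connEvent ends a₁ a₂)ᶜ) * prob p (connEvent ends a₂ o ∩ (connEvent ends a₁ a₂)ᶜ) +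
                prob p (connEvent ends a₁ a₂)ᶜ * prob p (connEvent ends a₂ b ∩ connEvent ends a₁ o ∩ (connEvent ends a₁ a₂)ᶜ) - prob p (connEvent ends a₂ b ∩ (connEvent ends a₁ a₂)ᶜ) * prob p (connEvent ends a₁ o ∩ (connEvent ends a₁ a₂)ᶜ))) -
      (1 - prob p (restrictTo (side₁ ends V₁)ᶜ ⁻¹' connEvent ends u c)) *
        (2 * prob p (connEvent ends a₁ a₂)ᶜ *
         (prob p (connEvent ends a₁ a₂)ᶜ * prob p (connEvent ends a₁ b ∩ connEvent ends a₂ o ∩ (connEvent ends a₁ a₂)ᶜ) - prob p (connEvent ends a₁ b ∩ (connEvent ends a₁ a₂)ᶜ) * prob p (connEvent ends a₂ o ∩ (connEvent ends a₁ a₂)ᶜ) +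
          prob p (connEvent ends a₁ a₂)ᶜ * prob p (connEvent ends a₂ b ∩ connEvent ends a₁ o ∩ (connEvent ends a₁ a₂)ᶜ) - prob p (connEvent ends a₂ b ∩ (connEvent ends a₁ a₂)ᶜ) * prob p (connEvent ends a₁ o ∩ (connEvent ends a₁ a₂)ᶜ))) := by
  classical
  have hc₁ : c ∈ V₁ := hs.a₁_mem.1
  have det : ∀ {x y : V}, x ∈ V₁ → y ∈ V₁ → ∀ ω, ω ∈ connEvent ends x y ↔
      restrictTo (side₁ ends V₁) ω ∈ connEvent ends x y :=
    fun hx hy ω => conn_detour hs (ω := ω) hx hy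
  have dD : ∀ ω, ω ∈ (connEvent ends a₁ a₂)ᶜ ↔
      restrictTo (side₁ ends V₁) ω ∈ (connEvent ends a₁ a₂)ᶜ := fun ω => by
    have := det ha₁ ha₂ ω
    simp only [Set.mem_compl_iff]
    tauto
  have dand : ∀ {X Y : Set (Config E)}, (∀ ω, ω ∈ X ↔ restrictTo (side₁ ends V₁) ω ∈ X) →
      (∀ ω, ω ∈ Y ↔ restrictTo (side₁ ends V₁) ω ∈ Y) →
      ∀ ω, ω ∈ X ∩ Y ↔ restrictTo (side₁ ends V₁) ω ∈ X ∩ Y := fun hX hY ω => by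
    have := hX ω; have := hY ω
    simp only [Set.mem_inter_iff]
    tauto
  have dor : ∀ {X Y : Set (Config E)}, (∀ ω, ω ∈ X ↔ restrictTo (side₁ ends V₁) ω ∈ X) →
      (∀ ω, ω ∈ Y ↔ restrictTo (side₁ ends V₁) ω ∈ Y) →
      ∀ ω, ω ∈ X ∪ Y ↔ restrictTo (side₁ ends V₁) ω ∈ X ∪ Y := fun hX hY ω => by
    have := hX ω; have := hY ω
    simp only [Set.mem_union]
    tauto
  set D := (connEvent ends a₁ a₂)ᶜ with hDdef
  set Lb := connEvent ends a₁ b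
  set Hb := connEvent ends a₂ b
  set Lu := connEvent ends a₁ u
  set Hu := connEvent ends a₂ u
  set Lo := connEvent ends a₁ o
  set Ho := connEvent ends a₂ o
  set Lc := connEvent ends a₁ c
  set Hc := connEvent ends a₂ c
  have dLb := det ha₁ hb
  have dHb := det ha₂ hb
  have doU := dor (det ha₁ ho) (det ha₂ ho)
  have G1 := prob_pendant_mul p (a₁ := a₂) hs ha₂ hu (Y := connEvent ends a₁ b ∩ (connEvent ends a₁ o ∪ connEvent ends a₂ o) ∩ (connEvent ends a₁ a₂)ᶜ) (dand (dand dLb doU) dD)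
  have G2 := prob_pendant_mul p (a₁ := a₂) hs ha₂ hu (Y := (connEvent ends a₁ o ∪ connEvent ends a₂ o) ∩ (connEvent ends a₁ a₂)ᶜ) (dand doU dD)
  have G3 := prob_pendant_mul p (a₁ := a₂) hs ha₂ hu (Y := connEvent ends a₁ b ∩ (connEvent ends a₁ a₂)ᶜ) (dand dLb dD)
  have G4 := prob_pendant_mul p (a₁ := a₂) hs ha₂ hu (Y := (connEvent ends a₁ a₂)ᶜ) dD
  have F1 := prob_pendant_mul p hs ha₁ hu (Y := connEvent ends a₂ b ∩ (connEvent ends a₁ o ∪ connEvent ends a₂ o) ∩ (connEvent ends a₁ a₂)ᶜ) (dand (dand dHb doU) dD)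
  have F2 := prob_pendant_mul p hs ha₁ hu (Y := (connEvent ends a₁ o ∪ connEvent ends a₂ o) ∩ (connEvent ends a₁ a₂)ᶜ) (dand doU dD)
  have F3 := prob_pendant_mul p hs ha₁ hu (Y := connEvent ends a₂ b ∩ (connEvent ends a₁ a₂)ᶜ) (dand dHb dD)
  have F4 := prob_pendant_mul p hs ha₁ hu (Y := (connEvent ends a₁ a₂)ᶜ) dD
  have U1 := prob_pendant_union_mul p hs ha₁ ha₂ hu (Y := (connEvent ends a₁ a₂)ᶜ) dD
  have a1 : Lb ∩ Hu ∩ (Lo ∪ Ho) ∩ D = Hu ∩ (Lb ∩ (Lo ∪ Ho) ∩ D) := by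
    ext ω; simp only [Set.mem_inter_iff, Set.mem_union]; tauto
  have a2 : Hu ∩ (Lo ∪ Ho) ∩ D = Hu ∩ ((Lo ∪ Ho) ∩ D) := by
    ext ω; simp only [Set.mem_inter_iff, Set.mem_union]; tauto
  have a3 : Lb ∩ Hu ∩ D = Hu ∩ (Lb ∩ D) := by
    ext ω; simp only [Set.mem_inter_iff]; tauto
  have b1 : Hb ∩ Lu ∩ (Lo ∪ Ho) ∩ D = Lu ∩ (Hb ∩ (Lo ∪ Ho) ∩ D) := by
    ext ω; simp only [Set.mem_inter_iff, Set.mem_union]; tauto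
  have b2 : Lu ∩ (Lo ∪ Ho) ∩ D = Lu ∩ ((Lo ∪ Ho) ∩ D) := by
    ext ω; simp only [Set.mem_inter_iff, Set.mem_union]; tauto
  have b3 : Hb ∩ Lu ∩ D = Lu ∩ (Hb ∩ D) := by
    ext ω; simp only [Set.mem_inter_iff]; tauto
  have c1 : Hc ∩ (Lb ∩ (Lo ∪ Ho) ∩ D) = Lb ∩ Hc ∩ (Lo ∪ Ho) ∩ D := by
    ext ω; simp only [Set.mem_inter_iff, Set.mem_union]; tauto
  have c2 : Hc ∩ ((Lo ∪ Ho) ∩ D) = Hc ∩ (Lo ∪ Ho) ∩ D := by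
    ext ω; simp only [Set.mem_inter_iff, Set.mem_union]; tauto
  have c3 : Hc ∩ (Lb ∩ D) = Lb ∩ Hc ∩ D := by
    ext ω; simp only [Set.mem_inter_iff]; tauto
  have d1 : Lc ∩ (Hb ∩ (Lo ∪ Ho) ∩ D) = Hb ∩ Lc ∩ (Lo ∪ Ho) ∩ D := by
    ext ω; simp only [Set.mem_inter_iff, Set.mem_union]; tauto
  have d2 : Lc ∩ ((Lo ∪ Ho) ∩ D) = Lc ∩ (Lo ∪ Ho) ∩ D := by
    ext ω; simp only [Set.mem_inter_iff, Set.mem_union]; tauto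
  have d3 : Lc ∩ (Hb ∩ D) = Hb ∩ Lc ∩ D := by
    ext ω; simp only [Set.mem_inter_iff]; tauto
  rw [a1, a2, a3, b1, b2, b3, G1, G2, G3, G4, F1, F2, F3, F4, U1, c1, c2, c3, d1, d2, d3]
  ring

/-- **Pendant `u`, typed, sign form.**  `β₁(o, u, b) ≥ P(γ_u) · β₁(o, c, b)` (BHK 1.4 twice). -/
theorem beta1_pendant_u_ge [Fintype V] [DecidableEq V] [LinearOrder R] [IsStrictOrderedRing R]
    (p : E → R) (hp : IsProbVec p) {ends : E → Sym2 V} {c a₁ a₂ : V} {V₁ V₂ : Set V}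
    (hs : IsRootPairSep ends c c V₁ V₂) [DecidablePred (· ∈ side₁ ends V₁)]
    [DecidablePred (· ∈ (side₁ ends V₁)ᶜ)] (ha₁ : a₁ ∈ V₁) (ha₂ : a₂ ∈ V₁) {o u b : V}
    (ho : o ∈ V₁) (hu : u ∈ V₂) (hb : b ∈ V₁) :
    prob p (restrictTo (side₁ ends V₁)ᶜ ⁻¹' connEvent ends u c) *
       (        prob p (connEvent ends a₁ a₂)ᶜ *
              (prob p (connEvent ends a₁ a₂)ᶜ * prob p (connEvent ends a₁ b ∩ connEvent ends a₂ c ∩ (connEvent ends a₁ o ∪ connEvent ends a₂ o) ∩ (connEvent ends a₁ a₂)ᶜ) -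
                prob p (connEvent ends a₁ b ∩ (connEvent ends a₁ a₂)ᶜ) * prob p (connEvent ends a₂ c ∩ (connEvent ends a₁ o ∪ connEvent ends a₂ o) ∩ (connEvent ends a₁ a₂)ᶜ)) -
            prob p ((connEvent ends a₁ o ∪ connEvent ends a₂ o) ∩ (connEvent ends a₁ a₂)ᶜ) *
              (prob p (connEvent ends a₁ a₂)ᶜ * prob p (connEvent ends a₁ b ∩ connEvent ends a₂ c ∩ (connEvent ends a₁ a₂)ᶜ) -
                prob p (connEvent ends a₁ b ∩ (connEvent ends a₁ a₂)ᶜ) * prob p (connEvent ends a₂ c ∩ (connEvent ends a₁ a₂)ᶜ)) -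
            prob p (connEvent ends a₁ a₂)ᶜ *
              (prob p (connEvent ends a₁ a₂)ᶜ * prob p (connEvent ends a₁ b ∩ connEvent ends a₂ o ∩ (connEvent ends a₁ a₂)ᶜ) -
                prob p (connEvent ends a₁ b ∩ (connEvent ends a₁ a₂)ᶜ) * prob p (connEvent ends a₂ o ∩ (connEvent ends a₁ a₂)ᶜ)) +
            prob p (connEvent ends a₁ a₂)ᶜ *
              (prob p (connEvent ends a₁ a₂)ᶜ * prob p (connEvent ends a₂ b ∩ connEvent ends a₁ c ∩ (connEvent ends a₁ o ∪ connEvent ends a₂ o) ∩ (connEvent ends a₁ a₂)ᶜ) -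
                prob p (connEvent ends a₂ b ∩ (connEvent ends a₁ a₂)ᶜ) * prob p (connEvent ends a₁ c ∩ (connEvent ends a₁ o ∪ connEvent ends a₂ o) ∩ (connEvent ends a₁ a₂)ᶜ)) -
            prob p ((connEvent ends a₁ o ∪ connEvent ends a₂ o) ∩ (connEvent ends a₁ a₂)ᶜ) *
              (prob p (connEvent ends a₁ a₂)ᶜ * prob p (connEvent ends a₂ b ∩ connEvent ends a₁ c ∩ (connEvent ends a₁ a₂)ᶜ) -
                prob p (connEvent ends a₂ b ∩ (connEvent ends a₁ a₂)ᶜ) * prob p (connEvent ends a₁ c ∩ (connEvent ends a₁ a₂)ᶜ)) -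
            prob p (connEvent ends a₁ a₂)ᶜ *
              (prob p (connEvent ends a₁ a₂)ᶜ * prob p (connEvent ends a₂ b ∩ connEvent ends a₁ o ∩ (connEvent ends a₁ a₂)ᶜ) -
                prob p (connEvent ends a₂ b ∩ (connEvent ends a₁ a₂)ᶜ) * prob p (connEvent ends a₁ o ∩ (connEvent ends a₁ a₂)ᶜ)) +
            (prob p ((connEvent ends a₁ c ∪ connEvent ends a₂ c) ∩ (connEvent ends a₁ a₂)ᶜ) - prob p (connEvent ends a₁ a₂)ᶜ) *
              (prob p (connEvent ends a₁ a₂)ᶜ * prob p (connEvent ends a₁ b ∩ connEvent ends a₂ o ∩ (connEvent ends a₁ a₂)ᶜ) - prob p (connEvent ends a₁ b ∩ (connEvent ends a₁ a₂)ᶜ) * prob p (connEvent ends a₂ o ∩ (connEvent ends a₁ a₂)ᶜ) +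
                prob p (connEvent ends a₁ a₂)ᶜ * prob p (connEvent ends a₂ b ∩ connEvent ends a₁ o ∩ (connEvent ends a₁ a₂)ᶜ) - prob p (connEvent ends a₂ b ∩ (connEvent ends a₁ a₂)ᶜ) * prob p (connEvent ends a₁ o ∩ (connEvent ends a₁ a₂)ᶜ))) ≤
    prob p (connEvent ends a₁ a₂)ᶜ *
          (prob p (connEvent ends a₁ a₂)ᶜ * prob p (connEvent ends a₁ b ∩ connEvent ends a₂ u ∩ (connEvent ends a₁ o ∪ connEvent ends a₂ o) ∩ (connEvent ends a₁ a₂)ᶜ) -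
            prob p (connEvent ends a₁ b ∩ (connEvent ends a₁ a₂)ᶜ) * prob p (connEvent ends a₂ u ∩ (connEvent ends a₁ o ∪ connEvent ends a₂ o) ∩ (connEvent ends a₁ a₂)ᶜ)) -
        prob p ((connEvent ends a₁ o ∪ connEvent ends a₂ o) ∩ (connEvent ends a₁ a₂)ᶜ) *
          (prob p (connEvent ends a₁ a₂)ᶜ * prob p (connEvent ends a₁ b ∩ connEvent ends a₂ u ∩ (connEvent ends a₁ a₂)ᶜ) -
            prob p (connEvent ends a₁ b ∩ (connEvent ends a₁ a₂)ᶜ) * prob p (connEvent ends a₂ u ∩ (connEvent ends a₁ a₂)ᶜ)) -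
        prob p (connEvent ends a₁ a₂)ᶜ *
          (prob p (connEvent ends a₁ a₂)ᶜ * prob p (connEvent ends a₁ b ∩ connEvent ends a₂ o ∩ (connEvent ends a₁ a₂)ᶜ) -
            prob p (connEvent ends a₁ b ∩ (connEvent ends a₁ a₂)ᶜ) * prob p (connEvent ends a₂ o ∩ (connEvent ends a₁ a₂)ᶜ)) +
        prob p (connEvent ends a₁ a₂)ᶜ *
          (prob p (connEvent ends a₁ a₂)ᶜ * prob p (connEvent ends a₂ b ∩ connEvent ends a₁ u ∩ (connEvent ends a₁ o ∪ connEvent ends a₂ o) ∩ (connEvent ends a₁ a₂)ᶜ) -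
            prob p (connEvent ends a₂ b ∩ (connEvent ends a₁ a₂)ᶜ) * prob p (connEvent ends a₁ u ∩ (connEvent ends a₁ o ∪ connEvent ends a₂ o) ∩ (connEvent ends a₁ a₂)ᶜ)) -
        prob p ((connEvent ends a₁ o ∪ connEvent ends a₂ o) ∩ (connEvent ends a₁ a₂)ᶜ) *
          (prob p (connEvent ends a₁ a₂)ᶜ * prob p (connEvent ends a₂ b ∩ connEvent ends a₁ u ∩ (connEvent ends a₁ a₂)ᶜ) -
            prob p (connEvent ends a₂ b ∩ (connEvent ends a₁ a₂)ᶜ) * prob p (connEvent ends a₁ u ∩ (connEvent ends a₁ a₂)ᶜ)) -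
        prob p (connEvent ends a₁ a₂)ᶜ *
          (prob p (connEvent ends a₁ a₂)ᶜ * prob p (connEvent ends a₂ b ∩ connEvent ends a₁ o ∩ (connEvent ends a₁ a₂)ᶜ) -
            prob p (connEvent ends a₂ b ∩ (connEvent ends a₁ a₂)ᶜ) * prob p (connEvent ends a₁ o ∩ (connEvent ends a₁ a₂)ᶜ)) +
        (prob p ((connEvent ends a₁ u ∪ connEvent ends a₂ u) ∩ (connEvent ends a₁ a₂)ᶜ) - prob p (connEvent ends a₁ a₂)ᶜ) *
          (prob p (connEvent ends a₁ a₂)ᶜ * prob p (connEvent ends a₁ b ∩ connEvent ends a₂ o ∩ (connEvent ends a₁ a₂)ᶜ) - prob p (connEvent ends a₁ b ∩ (connEvent ends a₁ a₂)ᶜ) * prob p (connEvent ends a₂ o ∩ (connEvent ends a₁ a₂)ᶜ) +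
            prob p (connEvent ends a₁ a₂)ᶜ * prob p (connEvent ends a₂ b ∩ connEvent ends a₁ o ∩ (connEvent ends a₁ a₂)ᶜ) - prob p (connEvent ends a₂ b ∩ (connEvent ends a₁ a₂)ᶜ) * prob p (connEvent ends a₁ o ∩ (connEvent ends a₁ a₂)ᶜ)) := by
  rw [beta1_pendant_u p hs ha₁ ha₂ ho hu hb]
  have B2 := bhk_cross_cluster p hp ends a₁ a₂ (𝓤 := {W : Set V | b ∈ W})
    (𝓥 := {W : Set V | o ∈ W}) (fun _ _ h hW => h hW) (fun _ _ h hW => h hW)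
  rw [RProduct.clusterInEvent_mem_eq, RProduct.clusterInEvent_mem_eq] at B2
  have B3 := bhk_cross_cluster p hp ends a₁ a₂ (𝓤 := {W : Set V | o ∈ W})
    (𝓥 := {W : Set V | b ∈ W}) (fun _ _ h hW => h hW) (fun _ _ h hW => h hW)
  rw [RProduct.clusterInEvent_mem_eq, RProduct.clusterInEvent_mem_eq] at B3
  have e : connEvent ends a₂ b ∩ connEvent ends a₁ o ∩ (connEvent ends a₁ a₂)ᶜ = connEvent ends a₁ o ∩ connEvent ends a₂ b ∩ (connEvent ends a₁ a₂)ᶜ := by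
    ext ω; simp only [Set.mem_inter_iff]; tauto
  rw [e]
  have hγ : prob p (restrictTo (side₁ ends V₁)ᶜ ⁻¹' connEvent ends u c) ≤ 1 := prob_le_one hp _
  have hQ : 0 ≤ prob p (connEvent ends a₁ a₂)ᶜ := prob_nonneg hp _
  have hT : 2 * prob p (connEvent ends a₁ a₂)ᶜ *
      (prob p (connEvent ends a₁ a₂)ᶜ * prob p (connEvent ends a₁ b ∩ connEvent ends a₂ o ∩ (connEvent ends a₁ a₂)ᶜ) - prob p (connEvent ends a₁ b ∩ (connEvent ends a₁ a₂)ᶜ) * prob p (connEvent ends a₂ o ∩ (connEvent ends a₁ a₂)ᶜ) +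
          prob p (connEvent ends a₁ a₂)ᶜ * prob p (connEvent ends a₁ o ∩ connEvent ends a₂ b ∩ (connEvent ends a₁ a₂)ᶜ) - prob p (connEvent ends a₂ b ∩ (connEvent ends a₁ a₂)ᶜ) * prob p (connEvent ends a₁ o ∩ (connEvent ends a₁ a₂)ᶜ)) ≤ 0 :=
    mul_nonpos_of_nonneg_of_nonpos (by linarith) (by linarith [B2, B3])
  nlinarith [mul_nonneg (sub_nonneg.2 hγ) (neg_nonneg.2 hT)]

end Main

end RootPairSep

end Summit.Ventures.PercRepro2
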